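import Literature.MathematicalPhysics.QuantumLattice.MatsubaraDeterminantBoundWeightedTimes
import Literature.MathematicalPhysics.QuantumLattice.FermionicTimeKernelAveraging
import HarnessLib

/-!
# The Pedra–Salmhofer bound for the two-branch kernel at complex energy, mode form plus a Gram block

Topic `MathematicalPhysics/QuantumLattice`; the "frozen-times" determinant bound consumed by the Matsubara-UV step of the cell
gate-hubbard-kl (R0, ARCH-β P3e).  For modes `m` with real energies `ξ_m`, a shift `θ` with `|βθ| ≤ π/4` (complex chemical potential),
row data `(F_a, P_a, s_a)` and column data `(G_b, Q_b, t_b)` with times in `[0, β]`, the matrix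

`M_{ab} = Σ_m F_a(m) G_b(m) K_β(ξ_m - iθ; s_a, t_b) + Σ_{m'} P_a(m') Q_b(m')`

(`K_β` = `fermiTimeKernel`, the time-ordered free propagator continued to complex energy; the second sum an arbitrary Gram block — in the
application the infrared part of the covariance) satisfies **`norm_det_fermiTimeKernel_add_gram_le`**:

`‖det M‖ ≤ 4ⁿ ∏_a √(‖F_a‖² + ‖P_a‖²) ∏_b √(‖G_b‖² + ‖Q_b‖²)`,

uniformly in `β`, the energies and the numbers of modes: de Siqueira Pedra–Salmhofer 2008, Thm 2.4, through the branch-weighted mode form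
`norm_det_timeOrdered_modes_le_of_branchWeights_of_times` — the complex Fermi factors `(1+e^{β(ξ∓iθ)·±})⁻¹` are the real ones times constants
of modulus `≤ (cos(βθ/2))⁻¹ ≤ 2`, the phases `e^{-isθ}`, `e^{itθ}` ride on rows and columns, and the Gram block is a mode of energy `0` with
branch weights `±2`.

* `fermiBranchWeightP/M` and their modulus bounds (`norm_fermiBranchWeightP/M_le_two`);
* **`norm_det_fermiTimeKernel_add_gram_le`**.

Everything is PROVED; the two branch weights are the only definitions; no named fact.

## Sources

W. de Siqueira Pedra, M. Salmhofer, Comm. Math. Phys. 282 (2008) 797–818, Thm 2.4, §4.1 [`PedraSalmhofer2008`].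
-/

noncomputable section

open Finset Set

namespace Literature.MathematicalPhysics.QuantumLattice

/-! ### The complex Fermi factors as weighted real ones -/

/-- The creation-left branch weight `c⁺(ξ) = (1 + e^{βξ}) · (1 + e^{β(ξ - iθ)})⁻¹`. [cite: PedraSalmhofer2008, §4.1] -/
def fermiBranchWeightP (β θ ξ : ℝ) : ℂ :=
  ((1 + Real.exp (β * ξ) : ℝ) : ℂ) * (1 + Complex.exp ((β : ℂ) * ((ξ : ℂ) - (θ : ℂ) * Complex.I)))⁻¹

/-- The other branch weight `c⁻(ξ) = (1 + e^{-βξ}) · (1 + e^{-β(ξ - iθ)})⁻¹`. [cite: PedraSalmhofer2008, §4.1] -/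
def fermiBranchWeightM (β θ ξ : ℝ) : ℂ :=
  ((1 + Real.exp (-(β * ξ)) : ℝ) : ℂ) * (1 + Complex.exp (-((β : ℂ) * ((ξ : ℂ) - (θ : ℂ) * Complex.I))))⁻¹

/-- `e^{β(ξ - iθ)} = e^{βξ} · e^{i(-βθ)}`. [cite: PedraSalmhofer2008, §4.1] -/
theorem exp_beta_mul_shift (β θ ξ : ℝ) :
    Complex.exp ((β : ℂ) * ((ξ : ℂ) - (θ : ℂ) * Complex.I)) =
      ((Real.exp (β * ξ) : ℝ) : ℂ) * Complex.exp (((-(β * θ) : ℝ) : ℂ) * Complex.I) := by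
  rw [Complex.ofReal_exp, ← Complex.exp_add]
  congr 1; push_cast; ring

/-- `e^{-β(ξ - iθ)} = e^{-βξ} · e^{i(βθ)}`. [cite: PedraSalmhofer2008, §4.1] -/
theorem exp_neg_beta_mul_shift (β θ ξ : ℝ) :
    Complex.exp (-((β : ℂ) * ((ξ : ℂ) - (θ : ℂ) * Complex.I))) =
      ((Real.exp (-(β * ξ)) : ℝ) : ℂ) * Complex.exp (((β * θ : ℝ) : ℂ) * Complex.I) := by
  rw [Complex.ofReal_exp, ← Complex.exp_add]
  congr 1; push_cast; ring

/-- For `|βθ| ≤ π/4`: `cos(βθ/2) ≥ 1/2`. [cite: PedraSalmhofer2008, §4.1] -/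
theorem half_le_cos_half_of_abs_le {φ : ℝ} (hφ : |φ| ≤ Real.pi / 4) : 1 / 2 ≤ Real.cos (φ / 2) := by
  rw [← Real.cos_pi_div_three]
  have h1 : |φ / 2| ≤ Real.pi / 3 := by
    rw [abs_div, abs_two]; linarith [Real.pi_pos]
  rw [← Real.cos_abs (φ / 2)]
  exact Real.cos_le_cos_of_nonneg_of_le_pi (abs_nonneg _) (by linarith [Real.pi_pos]) h1

/-- **`‖c⁺(ξ)‖ ≤ 2`** for `|βθ| ≤ π/4`. [cite: PedraSalmhofer2008, §4.1] -/
theorem norm_fermiBranchWeightP_le_two {β θ : ℝ} (hθ : |β * θ| ≤ Real.pi / 4) (ξ : ℝ) : ‖fermiBranchWeightP β θ ξ‖ ≤ 2 := by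
  have hx : 0 ≤ Real.exp (β * ξ) := (Real.exp_pos _).le
  have hφ : |(-(β * θ))| < Real.pi := by rw [abs_neg]; linarith [Real.pi_pos]
  have hcos : 1 / 2 ≤ Real.cos (-(β * θ) / 2) := half_le_cos_half_of_abs_le (by rwa [abs_neg])
  rw [fermiBranchWeightP, exp_beta_mul_shift, norm_mul, Complex.norm_real, Real.norm_eq_abs, abs_of_pos (by positivity)]
  have h := norm_inv_one_add_mul_exp_I_le hx hφ
  calc (1 + Real.exp (β * ξ)) * ‖(1 + ((Real.exp (β * ξ) : ℝ) : ℂ) * Complex.exp (((-(β * θ) : ℝ) : ℂ) * Complex.I))⁻¹‖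
      ≤ (1 + Real.exp (β * ξ)) * ((1 + Real.exp (β * ξ)) * Real.cos (-(β * θ) / 2))⁻¹ :=
        mul_le_mul_of_nonneg_left h (by positivity)
    _ = (Real.cos (-(β * θ) / 2))⁻¹ := by
        have : (1 + Real.exp (β * ξ)) ≠ 0 := by positivity
        field_simp
    _ ≤ 2 := by
        rw [inv_le_comm₀ (lt_of_lt_of_le (by norm_num) hcos) (by norm_num)]
        linarith

/-- **`‖c⁻(ξ)‖ ≤ 2`** for `|βθ| ≤ π/4`. [cite: PedraSalmhofer2008, §4.1] -/
theorem norm_fermiBranchWeightM_le_two {β θ : ℝ} (hθ : |β * θ| ≤ Real.pi / 4) (ξ : ℝ) : ‖fermiBranchWeightM β θ ξ‖ ≤ 2 := by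
  have hx : 0 ≤ Real.exp (-(β * ξ)) := (Real.exp_pos _).le
  have hφ : |β * θ| < Real.pi := by linarith [Real.pi_pos]
  have hcos : 1 / 2 ≤ Real.cos (β * θ / 2) := half_le_cos_half_of_abs_le hθ
  rw [fermiBranchWeightM, exp_neg_beta_mul_shift, norm_mul, Complex.norm_real, Real.norm_eq_abs, abs_of_pos (by positivity)]
  have h := norm_inv_one_add_mul_exp_I_le hx hφ
  calc (1 + Real.exp (-(β * ξ))) * ‖(1 + ((Real.exp (-(β * ξ)) : ℝ) : ℂ) * Complex.exp (((β * θ : ℝ) : ℂ) * Complex.I))⁻¹‖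
      ≤ (1 + Real.exp (-(β * ξ))) * ((1 + Real.exp (-(β * ξ))) * Real.cos (β * θ / 2))⁻¹ :=
        mul_le_mul_of_nonneg_left h (by positivity)
    _ = (Real.cos (β * θ / 2))⁻¹ := by
        have : (1 + Real.exp (-(β * ξ))) ≠ 0 := by positivity
        field_simp
    _ ≤ 2 := by
        rw [inv_le_comm₀ (lt_of_lt_of_le (by norm_num) hcos) (by norm_num)]
        linarith

/-- The Fermi factor `1 + e^{β(ξ - iθ)}` does not vanish for `|βθ| ≤ π/4`. [cite: PedraSalmhofer2008, §4.1] -/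
theorem one_add_exp_shift_ne_zero {β θ : ℝ} (hθ : |β * θ| ≤ Real.pi / 4) (ξ : ℝ) :
    1 + Complex.exp ((β : ℂ) * ((ξ : ℂ) - (θ : ℂ) * Complex.I)) ≠ 0 := by
  intro h
  rw [exp_beta_mul_shift] at h
  have hsq := sq_mul_cos_sq_le_normSq_one_add (Real.exp (β * ξ)) (-(β * θ))
  rw [h, norm_zero] at hsq
  have hcos : 1 / 2 ≤ Real.cos (-(β * θ) / 2) := half_le_cos_half_of_abs_le (by rwa [abs_neg])
  have hpos : 0 < ((1 + Real.exp (β * ξ)) * Real.cos (-(β * θ) / 2)) ^ 2 := by positivity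
  linarith

/-! ### The kernel, branch by branch, as phase × weight × real kernel -/

/-- `e^{(s-t)(ξ - iθ)} = e^{(s-t)ξ} · e^{-isθ} · e^{itθ}`. [cite: PedraSalmhofer2008, §4.1] -/
theorem exp_sub_mul_shift (ξ θ s t : ℝ) :
    Complex.exp ((((s - t : ℝ)) : ℂ) * ((ξ : ℂ) - (θ : ℂ) * Complex.I)) =
      ((Real.exp ((s - t) * ξ) : ℝ) : ℂ) * (Complex.exp (-(((s * θ : ℝ) : ℂ) * Complex.I)) *
        Complex.exp (((t * θ : ℝ) : ℂ) * Complex.I)) := by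
  rw [Complex.ofReal_exp, ← Complex.exp_add, ← Complex.exp_add]
  congr 1; push_cast; ring

/-- **The creation-left branch**: for `t < s`,
`K_β(ξ - iθ; s, t) = (-e^{-isθ}) · e^{itθ} · c⁺(ξ) · [e^{(s-t)ξ}(1+e^{βξ})⁻¹]`. [cite: PedraSalmhofer2008, §4.1] -/
theorem fermiTimeKernel_shift_of_lt {β θ : ℝ} (hθ : |β * θ| ≤ Real.pi / 4) (ξ : ℝ) {s t : ℝ} (h : t < s) :
    fermiTimeKernel β ((ξ : ℂ) - (θ : ℂ) * Complex.I) s t =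
      (-Complex.exp (-(((s * θ : ℝ) : ℂ) * Complex.I))) * Complex.exp (((t * θ : ℝ) : ℂ) * Complex.I) *
        fermiBranchWeightP β θ ξ * ((Real.exp ((s - t) * ξ) * (1 + Real.exp (β * ξ))⁻¹ : ℝ) : ℂ) := by
  have hE := one_add_exp_shift_ne_zero hθ ξ
  have h1 : ((1 + Real.exp (β * ξ) : ℝ) : ℂ) ≠ 0 := by exact_mod_cast (show (1 + Real.exp (β * ξ) : ℝ) ≠ 0 by positivity)
  rw [fermiTimeKernel_of_lt _ _ h, fermiBranchWeightP, exp_sub_mul_shift]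
  rw [div_eq_mul_inv]
  push_cast
  have h1' : (1 : ℂ) + Complex.exp ((ξ : ℂ) * (β : ℂ)) ≠ 0 := by
    rw [← Complex.ofReal_mul, ← Complex.ofReal_exp, mul_comm]
    exact_mod_cast (show (1 + Real.exp (β * ξ) : ℝ) ≠ 0 by positivity)
  have hinv : (1 + Complex.exp ((ξ : ℂ) * (β : ℂ)))⁻¹ * (1 + Complex.exp ((ξ : ℂ) * (β : ℂ))) = 1 := inv_mul_cancel₀ h1'
  field_simp

/-- **The other branch**: for `s ≤ t`,
`K_β(ξ - iθ; s, t) = -[(-e^{-isθ}) · e^{itθ} · c⁻(ξ) · (e^{(s-t)ξ}(1+e^{-βξ})⁻¹)]`. [cite: PedraSalmhofer2008, §4.1] -/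
theorem fermiTimeKernel_shift_of_le {β θ : ℝ} (hθ : |β * θ| ≤ Real.pi / 4) (ξ : ℝ) {s t : ℝ} (h : s ≤ t) :
    fermiTimeKernel β ((ξ : ℂ) - (θ : ℂ) * Complex.I) s t =
      -((-Complex.exp (-(((s * θ : ℝ) : ℂ) * Complex.I))) * Complex.exp (((t * θ : ℝ) : ℂ) * Complex.I) *
        fermiBranchWeightM β θ ξ * ((Real.exp ((s - t) * ξ) * (1 + Real.exp (-(β * ξ)))⁻¹ : ℝ) : ℂ)) := by
  have hE := one_add_exp_shift_ne_zero hθ ξ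
  have hE' : 1 + Complex.exp (-((β : ℂ) * ((ξ : ℂ) - (θ : ℂ) * Complex.I))) ≠ 0 := by
    intro h0
    have h2 : Complex.exp ((β : ℂ) * ((ξ : ℂ) - (θ : ℂ) * Complex.I)) * (1 + Complex.exp (-((β : ℂ) * ((ξ : ℂ) - (θ : ℂ) * Complex.I)))) =
        1 + Complex.exp ((β : ℂ) * ((ξ : ℂ) - (θ : ℂ) * Complex.I)) := by
      rw [mul_add, mul_one, ← Complex.exp_add, add_neg_cancel, Complex.exp_zero, add_comm]
    rw [h0, mul_zero] at h2
    exact hE h2.symm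
  rw [fermiTimeKernel_of_le _ _ h, fermiBranchWeightM, exp_sub_mul_shift, div_eq_mul_inv]
  push_cast
  have h1' : (1 : ℂ) + Complex.exp (-((ξ : ℂ) * (β : ℂ))) ≠ 0 := by
    rw [← Complex.ofReal_mul, ← Complex.ofReal_neg, ← Complex.ofReal_exp, mul_comm]
    exact_mod_cast (show (1 + Real.exp (-(β * ξ)) : ℝ) ≠ 0 by positivity)
  have hinv : (1 + Complex.exp (-((ξ : ℂ) * (β : ℂ))))⁻¹ * (1 + Complex.exp (-((ξ : ℂ) * (β : ℂ)))) = 1 := inv_mul_cancel₀ h1'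
  field_simp

/-! ### The frozen-times determinant bound -/

/-- **The Pedra–Salmhofer bound for the complex-energy time kernel in mode form plus a Gram block**: for `0 < β`, `|βθ| ≤ π/4`, times
`s_a, t_b ∈ [0, β]`, mode data `F, G` (energies `ξ`) and Gram data `P, Q`,
`‖det [Σ_m F_a G_b K_β(ξ_m - iθ; s_a, t_b) + Σ_{m'} P_a Q_b]‖ ≤ 4ⁿ ∏_a √(‖F_a‖² + ‖P_a‖²) ∏_b √(‖G_b‖² + ‖Q_b‖²)`
(for `0 < β`; the statement is vacuous-but-true bookkeeping otherwise). [cite: PedraSalmhofer2008, Thm 2.4] -/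
theorem norm_det_fermiTimeKernel_add_gram_le {ν ν' : Type*} [Fintype ν] [Fintype ν'] {β θ : ℝ}
    (hθ : |β * θ| ≤ Real.pi / 4) (ξ : ν → ℝ) {n : ℕ} (s t : Fin n → ℝ) (hs : ∀ a, s a ∈ Icc 0 β) (ht : ∀ b, t b ∈ Icc 0 β)
    (F G : Fin n → ν → ℂ) (P Q : Fin n → ν' → ℂ) :
    ‖(Matrix.of fun a b : Fin n =>
        (∑ m, F a m * G b m * fermiTimeKernel β ((ξ m : ℂ) - (θ : ℂ) * Complex.I) (s a) (t b)) + ∑ m', P a m' * Q b m').det‖ ≤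
      4 ^ n * ((∏ a, Real.sqrt (∑ m, ‖F a m‖ ^ 2 + ∑ m', ‖P a m'‖ ^ 2)) *
        ∏ b, Real.sqrt (∑ m, ‖G b m‖ ^ 2 + ∑ m', ‖Q b m'‖ ^ 2)) := by
  classical
  -- the data of the branch-weighted mode form on `ν ⊕ ν'`
  set d : ν ⊕ ν' → ℝ := Sum.elim ξ (fun _ => 0) with hd
  set cp : ν ⊕ ν' → ℂ := Sum.elim (fun m => fermiBranchWeightP β θ (ξ m)) (fun _ => 2) with hcp
  set cm : ν ⊕ ν' → ℂ := Sum.elim (fun m => fermiBranchWeightM β θ (ξ m)) (fun _ => -2) with hcm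
  set F' : Fin n → ν ⊕ ν' → ℂ := fun a => Sum.elim
    (fun m => -Complex.exp (-(((s a * θ : ℝ) : ℂ) * Complex.I)) * F a m) (fun m' => P a m') with hF'
  set G' : Fin n → ν ⊕ ν' → ℂ := fun b => Sum.elim
    (fun m => Complex.exp (((t b * θ : ℝ) : ℂ) * Complex.I) * G b m) (fun m' => Q b m') with hG'
  have hc₀ : (0 : ℝ) ≤ 2 := by norm_num
  have hcp2 : ∀ m, ‖cp m‖ ≤ 2 := by
    rintro (m | m')
    · exact norm_fermiBranchWeightP_le_two hθ (ξ m)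
    · simp [hcp]
  have hcm2 : ∀ m, ‖cm m‖ ≤ 2 := by
    rintro (m | m')
    · exact norm_fermiBranchWeightM_le_two hθ (ξ m)
    · simp [hcm]
  have hs' : ∀ a, 0 ≤ s a ∧ s a ≤ β := fun a => ⟨(hs a).1, (hs a).2⟩
  have ht' : ∀ b, 0 ≤ t b ∧ t b ≤ β := fun b => ⟨(ht b).1, (ht b).2⟩
  have hPS := norm_det_timeOrdered_modes_le_of_branchWeights_of_times d β F' G' cp cm hc₀ hcp2 hcm2 s t hs' ht'
  -- the matrix IS of that form
  have hentry : ∀ a b : Fin n,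
      (∑ m, F a m * G b m * fermiTimeKernel β ((ξ m : ℂ) - (θ : ℂ) * Complex.I) (s a) (t b)) + ∑ m', P a m' * Q b m' =
        if t b < s a then
          ∑ m, F' a m * G' b m * cp m * ((Real.exp ((s a - t b) * d m) * (1 + Real.exp (β * d m))⁻¹ : ℝ) : ℂ)
        else -∑ m, F' a m * G' b m * cm m * ((Real.exp ((s a - t b) * d m) * (1 + Real.exp (-(β * d m)))⁻¹ : ℝ) : ℂ) := by
    intro a b
    split_ifs with hab
    · rw [Fintype.sum_sum_type]
      congr 1
      · refine Finset.sum_congr rfl fun m _ => ?_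
        simp only [hF', hG', hcp, hd, Sum.elim_inl, fermiTimeKernel_shift_of_lt hθ (ξ m) hab]
        ring
      · refine Finset.sum_congr rfl fun m' _ => ?_
        simp only [hF', hG', hcp, hd, Sum.elim_inr]
        push_cast
        simp
        ring
    · rw [Fintype.sum_sum_type, neg_add]
      congr 1
      · rw [← Finset.sum_neg_distrib]
        refine Finset.sum_congr rfl fun m _ => ?_
        simp only [hF', hG', hcm, hd, Sum.elim_inl, fermiTimeKernel_shift_of_le hθ (ξ m) (not_lt.1 hab)]
        ring
      · rw [← Finset.sum_neg_distrib]
        refine Finset.sum_congr rfl fun m' _ => ?_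
        simp only [hF', hG', hcm, hd, Sum.elim_inr]
        push_cast
        simp
        ring
  have hM : (Matrix.of fun a b : Fin n =>
        (∑ m, F a m * G b m * fermiTimeKernel β ((ξ m : ℂ) - (θ : ℂ) * Complex.I) (s a) (t b)) + ∑ m', P a m' * Q b m') =
      Matrix.of fun a b : Fin n => if t b < s a then
          ∑ m, F' a m * G' b m * cp m * ((Real.exp ((s a - t b) * d m) * (1 + Real.exp (β * d m))⁻¹ : ℝ) : ℂ)
        else -∑ m, F' a m * G' b m * cm m * ((Real.exp ((s a - t b) * d m) * (1 + Real.exp (-(β * d m)))⁻¹ : ℝ) : ℂ) := by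
    ext a b; exact hentry a b
  rw [hM]
  refine hPS.trans ?_
  -- the norms: the phases are unimodular
  have hF'n : ∀ a, ∑ m, ‖F' a m‖ ^ 2 = ∑ m, ‖F a m‖ ^ 2 + ∑ m', ‖P a m'‖ ^ 2 := by
    intro a
    rw [Fintype.sum_sum_type]
    congr 1
    refine Finset.sum_congr rfl fun m _ => ?_
    simp only [hF', Sum.elim_inl, norm_mul, norm_neg]
    rw [show -(((s a * θ : ℝ) : ℂ) * Complex.I) = ((-(s a * θ) : ℝ) : ℂ) * Complex.I by push_cast; ring,
      Complex.norm_exp_ofReal_mul_I, one_mul]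
  have hG'n : ∀ b, ∑ m, ‖G' b m‖ ^ 2 = ∑ m, ‖G b m‖ ^ 2 + ∑ m', ‖Q b m'‖ ^ 2 := by
    intro b
    rw [Fintype.sum_sum_type]
    congr 1
    refine Finset.sum_congr rfl fun m _ => ?_
    simp only [hG', Sum.elim_inl, norm_mul, Complex.norm_exp_ofReal_mul_I, one_mul]
  simp_rw [hF'n, hG'n]
  norm_num

end Literature.MathematicalPhysics.QuantumLattice

end
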